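import Literature.Probability.RandomPlanarGeometry.SAWStripPartitionFunction
import Literature.Probability.RandomPlanarGeometry.SquaredWalkPolygons
import Literature.Probability.Percolation.SiteConnectionTools
import Literature.Probability.LatticeModels.IsoradialGraphsProofs
import HarnessLib

/-!
# Connector toolkit — stub `stub_connectorToolkit` of line `rectangle-windows`
(crux EdgeOfPositivity, stmt-CriticalPhenomena-11344)

Two elementary injections between self-avoiding walks of `ℤ²` confined to lattice rectangles
`{0..ℓ} × {1..n}` (`SAW.stripSAWs`), compared through the fugacity-`x` graded sums
`Zs[x,n,ℓ,a,b] = Σ_s x^s · #stripSAWs n ℓ s a b` (`x ≥ 0`), `Thr[x,n,ℓ] = Zs[x,n,ℓ,(0,1),(ℓ,1)]`: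

* (T1) fresh-column connectors: a walk `(0,r) → (j,s)` of the `n`-strip of span `j`, translated
  one column to the right and completed by the vertical connectors `(0,1) ↑ (0,r) → (1,r)`
  (column `0`) and `(j+1,s) → (j+2,s) ↓ (j+2,1)` (column `j+2`), is a through walk
  `(0,1) → (j+2,1)` of span `j+2` with `r+s` more steps, whence
  `x^{r+s} · Zs[x,n,j,(0,r),(j,s)] ≤ Thr[x,n,j+2]`;
* (T4) corner connectors (`n, ℓ ≥ 1`): `(0,n) ↓ (0,1) → (1,1)` followed by a translated through
  walk of span `ℓ-1`, and a through walk of span `ℓ-1` followed by `(ℓ-1,1) → (ℓ,1) ↑ (ℓ,n)`,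
  give `x^n · Thr[x,n,ℓ-1] ≤ Zs[x,n,ℓ,(0,n),(ℓ,1)]` and `x^n · Thr[x,n,ℓ-1] ≤ Zs[x,n,ℓ,(0,1),(ℓ,n)]`.

Each map is injective (a walk is determined by its support, `Walk.ext_support`), keeps the walk
self-avoiding (the glued pieces live in disjoint column ranges) and inside the larger box, and
adds a fixed number of steps, so the graded sums compare degree by degree (`pow_mul_zs_le`, the
generic weighted-injection recipe: `Finset.card_le_card_of_injOn` in each degree, then a shift of
the summation range). Straight vertical walks are packaged as existence theorems
(`exists_upWalk`, `exists_downWalk`); translation by one column is `Walk.map` along the lattice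
automorphism `zdShiftIso (1,0)`. Sources: folklore lattice combinatorics (concatenation of
self-avoiding walks in disjoint regions, as in Madras–Slade, *The Self-Avoiding Walk*, §1.2).
-/

noncomputable section

open Finset SimpleGraph
open Literature.Probability.LatticeModels Literature.Probability.RandomPlanarGeometry
open Literature.Probability.Percolation (zdShiftIso zdShiftIso_apply)

namespace Summit.CriticalPhenomena.SAWScalingLimit.Theorems.EdgeOfPositivity.RectangleWindows.ConnectorToolkit

local notation3 (prettyPrint := false) "Zs[" x ", " n ", " ℓ ", " a ", " b "]" =>
  (∑ s ∈ Finset.range ((ℓ + 1) * n + 1), (x : ℝ) ^ s * ((SAW.stripSAWs n ℓ s a b).card : ℝ))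

local notation3 (prettyPrint := false) "Thr[" x ", " n ", " ℓ "]" =>
  (∑ s ∈ Finset.range ((ℓ + 1) * n + 1),
    (x : ℝ) ^ s * ((SAW.stripSAWs n ℓ s (![0, 1] : Site 2) (![((ℓ : ℕ) : ℤ), 1] : Site 2)).card : ℝ))

/-! ### The weighted-injection recipe -/

/-- Enlarging the cutoff of the graded sum changes nothing: no self-avoiding walk inside the box
`{0..ℓ} × {1..n}` has `(ℓ+1)n` or more steps. [folklore] -/
theorem zs_eq_sum_range {x : ℝ} {n ℓ M : ℕ} (hM : (ℓ + 1) * n + 1 ≤ M) (a b : Site 2) :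
    Zs[x, n, ℓ, a, b] = ∑ s ∈ Finset.range M, x ^ s * ((SAW.stripSAWs n ℓ s a b).card : ℝ) := by
  refine Finset.sum_subset (fun s hs => Finset.mem_range.2 ((Finset.mem_range.1 hs).trans_le hM))
    fun s _ hs => ?_
  have hs' : (ℓ + 1) * n ≤ s := by rw [Finset.mem_range, not_lt] at hs; omega
  rw [SAW.stripSAWs_eq_empty hs', Finset.card_empty, Nat.cast_zero, mul_zero]

/-- **Weighted injections.** If a map `f` on lattice walks sends every self-avoiding walk of the
box `{0..ℓ} × {1..n}` from `a` to `b` to a self-avoiding walk of the box `{0..ℓ'} × {1..n'}` from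
`c` to `d` with exactly `k` more steps, injectively, then `x^k · Zs[x,n,ℓ,a,b] ≤ Zs[x,n',ℓ',c,d]`
for `x ≥ 0`: degree by degree `#stripSAWs n ℓ s a b ≤ #stripSAWs n' ℓ' (s+k) c d`, and the
shifted graded sum is a partial sum of the target. [folklore] -/
theorem pow_mul_zs_le {x : ℝ} (hx : 0 ≤ x) {n ℓ n' ℓ' k : ℕ} {a b c d : Site 2}
    (f : (zdGraph 2).Walk a b → (zdGraph 2).Walk c d) (hinj : Function.Injective f)
    (hf : ∀ p : (zdGraph 2).Walk a b, p.IsPath → (∀ v ∈ p.support, v ∈ SAW.stripBox n ℓ) →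
      (f p).IsPath ∧ (∀ v ∈ (f p).support, v ∈ SAW.stripBox n' ℓ') ∧
        (f p).length = p.length + k) :
    x ^ k * Zs[x, n, ℓ, a, b] ≤ Zs[x, n', ℓ', c, d] := by
  have hcard : ∀ s : ℕ, ((SAW.stripSAWs n ℓ s a b).card : ℝ) ≤
      ((SAW.stripSAWs n' ℓ' (k + s) c d).card : ℝ) := by
    intro s
    have h : (SAW.stripSAWs n ℓ s a b).card ≤ (SAW.stripSAWs n' ℓ' (k + s) c d).card := by
      refine Finset.card_le_card_of_injOn f (fun p hp => ?_) hinj.injOn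
      obtain ⟨hlen, hpath, hbox⟩ := SAW.mem_stripSAWs.1 (Finset.mem_coe.1 hp)
      obtain ⟨h1, h2, h3⟩ := hf p hpath hbox
      exact Finset.mem_coe.2 (SAW.mem_stripSAWs.2 ⟨by rw [h3, hlen, add_comm], h1, h2⟩)
    exact_mod_cast h
  have hnn : ∀ u : ℕ, 0 ≤ x ^ u * ((SAW.stripSAWs n' ℓ' u c d).card : ℝ) := fun u =>
    mul_nonneg (pow_nonneg hx u) (Nat.cast_nonneg _)
  calc x ^ k * Zs[x, n, ℓ, a, b]
      = ∑ s ∈ Finset.range ((ℓ + 1) * n + 1),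
          x ^ (k + s) * ((SAW.stripSAWs n ℓ s a b).card : ℝ) := by
        rw [Finset.mul_sum]
        refine Finset.sum_congr rfl fun s _ => ?_
        rw [pow_add, mul_assoc]
    _ ≤ ∑ s ∈ Finset.range ((ℓ + 1) * n + 1),
          x ^ (k + s) * ((SAW.stripSAWs n' ℓ' (k + s) c d).card : ℝ) :=
        Finset.sum_le_sum fun s _ => mul_le_mul_of_nonneg_left (hcard s) (pow_nonneg hx _)
    _ ≤ (∑ u ∈ Finset.range k, x ^ u * ((SAW.stripSAWs n' ℓ' u c d).card : ℝ)) +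
          ∑ s ∈ Finset.range ((ℓ + 1) * n + 1),
            x ^ (k + s) * ((SAW.stripSAWs n' ℓ' (k + s) c d).card : ℝ) :=
        le_add_of_nonneg_left (Finset.sum_nonneg fun u _ => hnn u)
    _ = ∑ u ∈ Finset.range (k + ((ℓ + 1) * n + 1)),
          x ^ u * ((SAW.stripSAWs n' ℓ' u c d).card : ℝ) :=
        (Finset.sum_range_add _ _ _).symm
    _ ≤ ∑ u ∈ Finset.range (k + ((ℓ + 1) * n + 1) + ((ℓ' + 1) * n' + 1)),
          x ^ u * ((SAW.stripSAWs n' ℓ' u c d).card : ℝ) :=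
        Finset.sum_le_sum_of_subset_of_nonneg (Finset.range_subset_range.2 (by omega))
          fun u _ _ => hnn u
    _ = Zs[x, n', ℓ', c, d] := (zs_eq_sum_range (by omega) c d).symm

/-! ### Straight vertical walks and translation by one column -/

/-- The straight walk up the column `c` from row `a` to row `b = a + m`: `m` steps,
self-avoiding, all vertices in column `c` with rows in `[a, b]`. [folklore] -/
theorem exists_upWalk (c : ℤ) (m : ℕ) : ∀ (a b : ℤ), b = a + m →
    ∃ p : (zdGraph 2).Walk (![c, a] : Site 2) (![c, b] : Site 2), p.length = m ∧ p.IsPath ∧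
      ∀ v ∈ p.support, v 0 = c ∧ a ≤ v 1 ∧ v 1 ≤ b := by
  induction m with
  | zero =>
    intro a b hb
    obtain rfl : b = a := by omega
    refine ⟨Walk.nil, rfl, Walk.IsPath.nil, fun v hv => ?_⟩
    rw [Walk.support_nil, List.mem_singleton] at hv
    subst hv
    simp
  | succ m ih =>
    intro a b hb
    obtain ⟨p, hlen, hpath, hsupp⟩ := ih (a + 1) b (by push_cast at hb; omega)
    refine ⟨Walk.cons (zdGraph_two_adj_north c a) p, by rw [Walk.length_cons, hlen], ?_,
      fun v hv => ?_⟩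
    · refine hpath.cons fun h => ?_
      have h1 := (hsupp _ h).2.1
      have k1 : (![c, a] : Site 2) 1 = a := rfl
      omega
    · rw [Walk.support_cons, List.mem_cons] at hv
      rcases hv with rfl | hv
      · have k0 : (![c, a] : Site 2) 0 = c := rfl
        have k1 : (![c, a] : Site 2) 1 = a := rfl
        omega
      · obtain ⟨h0, h1, h2⟩ := hsupp v hv
        exact ⟨h0, by omega, h2⟩

/-- The straight walk down the column `c` from row `a = b + m` to row `b`: `m` steps,
self-avoiding, all vertices in column `c` with rows in `[b, a]`. [folklore] -/
theorem exists_downWalk (c : ℤ) (m : ℕ) (a b : ℤ) (h : a = b + m) :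
    ∃ p : (zdGraph 2).Walk (![c, a] : Site 2) (![c, b] : Site 2), p.length = m ∧ p.IsPath ∧
      ∀ v ∈ p.support, v 0 = c ∧ b ≤ v 1 ∧ v 1 ≤ a := by
  obtain ⟨p, hlen, hpath, hsupp⟩ := exists_upWalk c m b a h
  refine ⟨p.reverse, by rw [Walk.length_reverse, hlen], hpath.reverse, fun v hv => ?_⟩
  rw [Walk.support_reverse, List.mem_reverse] at hv
  exact hsupp v hv

/-- Vertices of the translate `γ + (1,0)` of a walk `γ` (with endpoints rewritten) are the
translates of the vertices of `γ`: columns shift by one, rows are unchanged. [folklore] -/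
theorem mem_support_shift {u v u' v' : Site 2} (hu : zdShiftIso (![1, 0] : Site 2) u = u')
    (hv : zdShiftIso (![1, 0] : Site 2) v = v') (γ : (zdGraph 2).Walk u v) {w : Site 2}
    (hw : w ∈ ((γ.map (zdShiftIso (![1, 0] : Site 2)).toHom).copy hu hv).support) :
    ∃ z ∈ γ.support, w 0 = z 0 + 1 ∧ w 1 = z 1 := by
  rw [Walk.support_copy, Walk.support_map, List.mem_map] at hw
  obtain ⟨z, hz, rfl⟩ := hw
  exact ⟨z, hz, by simp [Iso.toHom], by simp [Iso.toHom]⟩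

/-! ### (T1) Fresh-column connectors -/

/-- **Fresh-column connectors.** For `1 ≤ r, s ≤ n` there is an injective map sending each
walk `γ : (0,r) → (j,s)` to the walk `(0,1) ↑ (0,r) → (1,r)`, then `γ + (1,0)`, then
`(j+1,s) → (j+2,s) ↓ (j+2,1)`; it maps self-avoiding walks of the box `{0..j} × {1..n}` to
self-avoiding walks of the box `{0..j+2} × {1..n}` (the three pieces live in the column ranges
`{0}`, `{1..j+1}`, `{j+2}`) with exactly `r + s` more steps. [folklore] -/
theorem exists_freshColumnMap (n j : ℕ) (r s : ℤ) (h1r : 1 ≤ r) (hrn : r ≤ n) (h1s : 1 ≤ s)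
    (hsn : s ≤ n) :
    ∃ f : (zdGraph 2).Walk (![0, r] : Site 2) (![(j : ℤ), s] : Site 2) →
        (zdGraph 2).Walk (![0, 1] : Site 2) (![((j + 2 : ℕ) : ℤ), 1] : Site 2),
      Function.Injective f ∧
      ∀ p, p.IsPath → (∀ v ∈ p.support, v ∈ SAW.stripBox n j) →
        (f p).IsPath ∧ (∀ v ∈ (f p).support, v ∈ SAW.stripBox n (j + 2)) ∧
          (f p).length = p.length + (r + s).toNat := by
  obtain ⟨U, hUlen, hUpath, hUsupp⟩ := exists_upWalk 0 (r - 1).toNat 1 r (by omega)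
  obtain ⟨D, hDlen, hDpath, hDsupp⟩ :=
    exists_downWalk ((j + 2 : ℕ) : ℤ) (s - 1).toNat s 1 (by omega)
  have hA : (zdGraph 2).Adj (![0, r] : Site 2) ![1, r] := by
    have h := zdGraph_two_adj_east 0 r
    rwa [zero_add] at h
  have hB : (zdGraph 2).Adj (![(j : ℤ) + 1, s] : Site 2) ![((j + 2 : ℕ) : ℤ), s] := by
    have e : ((j + 2 : ℕ) : ℤ) = (j : ℤ) + 1 + 1 := by push_cast; ring
    rw [e]
    exact zdGraph_two_adj_east _ _
  have e1 : zdShiftIso (![1, 0] : Site 2) ![0, r] = ![1, r] := by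
    funext i; fin_cases i <;> simp
  have e2 : zdShiftIso (![1, 0] : Site 2) ![(j : ℤ), s] = ![(j : ℤ) + 1, s] := by
    funext i; fin_cases i <;> simp
  refine ⟨fun γ => U.append (Walk.cons hA
      (((γ.map (zdShiftIso (![1, 0] : Site 2)).toHom).copy e1 e2).append (Walk.cons hB D))),
    fun γ γ' h => ?_, fun γ hγp hγb => ?_⟩
  · -- injectivity: a walk is determined by its support
    have hs := congrArg Walk.support h
    simp only [Walk.support_append, Walk.support_cons, List.tail_cons, Walk.support_copy,
      Walk.support_map] at hs
    have hs' := List.append_cancel_right (List.append_cancel_left hs)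
    have hι : Function.Injective (zdShiftIso (![1, 0] : Site 2)).toHom := RelIso.injective _
    exact Walk.ext_support (List.map_injective_iff.2 hι hs')
  · have hX : ∀ w ∈ ((γ.map (zdShiftIso (![1, 0] : Site 2)).toHom).copy e1 e2).support,
        1 ≤ w 0 ∧ w 0 ≤ (j : ℤ) + 1 ∧ 1 ≤ w 1 ∧ w 1 ≤ n := by
      intro w hw
      obtain ⟨z, hz, h0, h1⟩ := mem_support_shift e1 e2 γ hw
      have hb := SAW.mem_stripBox.1 (hγb z hz)
      omega
    have hXpath : ((γ.map (zdShiftIso (![1, 0] : Site 2)).toHom).copy e1 e2).IsPath :=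
      (Walk.isPath_copy _ _ _).2 (hγp.map (RelIso.injective _))
    refine ⟨?_, fun v hv => ?_, ?_⟩
    · refine SAW.isPath_append_cons hA hUpath
        (SAW.isPath_append_cons hB hXpath hDpath fun w hw hw' => ?_) fun w hw hw' => ?_
      · have h0 := (hX w hw).2.1
        have h0' := (hDsupp w hw').1
        omega
      · have h0 := (hUsupp w hw).1
        simp only [Walk.mem_support_append_iff, Walk.support_cons, List.mem_cons] at hw'
        rcases hw' with hw' | rfl | hw'
        · have h0' := (hX w hw').1
          omega
        · simp only [Matrix.cons_val_zero] at h0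
          omega
        · have h0' := (hDsupp w hw').1
          omega
    · rw [SAW.mem_stripBox]
      simp only [Walk.mem_support_append_iff, Walk.support_cons, List.mem_cons] at hv
      rcases hv with hv | rfl | hv | rfl | hv
      · obtain ⟨h0, h1, h2⟩ := hUsupp v hv
        omega
      · simp only [Matrix.cons_val_zero, Matrix.cons_val_one]
        omega
      · have h := hX v hv
        omega
      · simp only [Matrix.cons_val_zero, Matrix.cons_val_one]
        omega
      · obtain ⟨h0, h1, h2⟩ := hDsupp v hv
        omega
    · simp only [Walk.length_append, Walk.length_cons, Walk.length_copy, Walk.length_map,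
        hUlen, hDlen]
      omega

/-! ### (T4) Corner connectors -/

/-- **Corner connector `TL → BR`.** For `n, ℓ ≥ 1` there is an injective map sending each
through walk `γ : (0,1) → (ℓ-1,1)` to the walk `(0,n) ↓ (0,1) → (1,1)` followed by `γ + (1,0)`;
it maps self-avoiding walks of the box `{0..ℓ-1} × {1..n}` to self-avoiding walks of the box
`{0..ℓ} × {1..n}` from `(0,n)` to `(ℓ,1)` (pieces in the column ranges `{0}`, `{1..ℓ}`) with
exactly `n` more steps. [folklore] -/
theorem exists_cornerMapTL (n ℓ : ℕ) (hn : 1 ≤ n) (hℓ : 1 ≤ ℓ) :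
    ∃ f : (zdGraph 2).Walk (![0, 1] : Site 2) (![((ℓ - 1 : ℕ) : ℤ), 1] : Site 2) →
        (zdGraph 2).Walk (![0, (n : ℤ)] : Site 2) (![(ℓ : ℤ), 1] : Site 2),
      Function.Injective f ∧
      ∀ p, p.IsPath → (∀ v ∈ p.support, v ∈ SAW.stripBox n (ℓ - 1)) →
        (f p).IsPath ∧ (∀ v ∈ (f p).support, v ∈ SAW.stripBox n ℓ) ∧
          (f p).length = p.length + n := by
  obtain ⟨D, hDlen, hDpath, hDsupp⟩ := exists_downWalk 0 (n - 1) (n : ℤ) 1 (by omega)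
  have hA : (zdGraph 2).Adj (![0, 1] : Site 2) ![1, 1] := by
    have h := zdGraph_two_adj_east 0 1
    rwa [zero_add] at h
  have e1 : zdShiftIso (![1, 0] : Site 2) ![0, 1] = ![1, 1] := by
    funext i; fin_cases i <;> simp
  have e2 : zdShiftIso (![1, 0] : Site 2) ![((ℓ - 1 : ℕ) : ℤ), 1] = ![(ℓ : ℤ), 1] := by
    have e : ((ℓ - 1 : ℕ) : ℤ) + 1 = ℓ := by omega
    funext i; fin_cases i <;> simp [e]
  refine ⟨fun γ => D.append (Walk.cons hA
      ((γ.map (zdShiftIso (![1, 0] : Site 2)).toHom).copy e1 e2)),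
    fun γ γ' h => ?_, fun γ hγp hγb => ?_⟩
  · have hs := congrArg Walk.support h
    simp only [Walk.support_append, Walk.support_cons, List.tail_cons, Walk.support_copy,
      Walk.support_map] at hs
    have hs' := List.append_cancel_left hs
    have hι : Function.Injective (zdShiftIso (![1, 0] : Site 2)).toHom := RelIso.injective _
    exact Walk.ext_support (List.map_injective_iff.2 hι hs')
  · have hX : ∀ w ∈ ((γ.map (zdShiftIso (![1, 0] : Site 2)).toHom).copy e1 e2).support,
        1 ≤ w 0 ∧ w 0 ≤ (ℓ : ℤ) ∧ 1 ≤ w 1 ∧ w 1 ≤ n := by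
      intro w hw
      obtain ⟨z, hz, h0, h1⟩ := mem_support_shift e1 e2 γ hw
      have hb := SAW.mem_stripBox.1 (hγb z hz)
      omega
    have hXpath : ((γ.map (zdShiftIso (![1, 0] : Site 2)).toHom).copy e1 e2).IsPath :=
      (Walk.isPath_copy _ _ _).2 (hγp.map (RelIso.injective _))
    refine ⟨?_, fun v hv => ?_, ?_⟩
    · refine SAW.isPath_append_cons hA hDpath hXpath fun w hw hw' => ?_
      have h0 := (hDsupp w hw).1
      have h0' := (hX w hw').1
      omega
    · rw [SAW.mem_stripBox]
      simp only [Walk.mem_support_append_iff, Walk.support_cons, List.mem_cons] at hv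
      rcases hv with hv | rfl | hv
      · obtain ⟨h0, h1, h2⟩ := hDsupp v hv
        omega
      · simp only [Matrix.cons_val_zero, Matrix.cons_val_one]
        omega
      · have h := hX v hv
        omega
    · simp only [Walk.length_append, Walk.length_cons, Walk.length_copy, Walk.length_map, hDlen]
      omega

/-- **Corner connector `BL → TR`.** For `n, ℓ ≥ 1` there is an injective map sending each
through walk `γ : (0,1) → (ℓ-1,1)` to `γ` followed by `(ℓ-1,1) → (ℓ,1) ↑ (ℓ,n)`; it maps
self-avoiding walks of the box `{0..ℓ-1} × {1..n}` to self-avoiding walks of the box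
`{0..ℓ} × {1..n}` from `(0,1)` to `(ℓ,n)` (pieces in the column ranges `{0..ℓ-1}`, `{ℓ}`) with
exactly `n` more steps. [folklore] -/
theorem exists_cornerMapTR (n ℓ : ℕ) (hn : 1 ≤ n) (hℓ : 1 ≤ ℓ) :
    ∃ f : (zdGraph 2).Walk (![0, 1] : Site 2) (![((ℓ - 1 : ℕ) : ℤ), 1] : Site 2) →
        (zdGraph 2).Walk (![0, 1] : Site 2) (![(ℓ : ℤ), (n : ℤ)] : Site 2),
      Function.Injective f ∧
      ∀ p, p.IsPath → (∀ v ∈ p.support, v ∈ SAW.stripBox n (ℓ - 1)) →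
        (f p).IsPath ∧ (∀ v ∈ (f p).support, v ∈ SAW.stripBox n ℓ) ∧
          (f p).length = p.length + n := by
  obtain ⟨U, hUlen, hUpath, hUsupp⟩ := exists_upWalk (ℓ : ℤ) (n - 1) 1 (n : ℤ) (by omega)
  have hB : (zdGraph 2).Adj (![((ℓ - 1 : ℕ) : ℤ), 1] : Site 2) ![(ℓ : ℤ), 1] := by
    have h := zdGraph_two_adj_east ((ℓ - 1 : ℕ) : ℤ) 1
    have e : ((ℓ - 1 : ℕ) : ℤ) + 1 = ℓ := by omega
    rwa [e] at h
  refine ⟨fun γ => γ.append (Walk.cons hB U), fun γ γ' h => ?_, fun γ hγp hγb => ?_⟩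
  · have hs := congrArg Walk.support h
    simp only [Walk.support_append, Walk.support_cons, List.tail_cons] at hs
    exact Walk.ext_support (List.append_cancel_right hs)
  · refine ⟨?_, fun v hv => ?_, ?_⟩
    · refine SAW.isPath_append_cons hB hγp hUpath fun w hw hw' => ?_
      have h0 := (SAW.mem_stripBox.1 (hγb w hw)).2.1
      have h0' := (hUsupp w hw').1
      omega
    · rw [SAW.mem_stripBox]
      simp only [Walk.mem_support_append_iff, Walk.support_cons, List.mem_cons] at hv
      rcases hv with hv | rfl | hv
      · have h := SAW.mem_stripBox.1 (hγb v hv)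
        omega
      · simp only [Matrix.cons_val_zero, Matrix.cons_val_one]
        omega
      · obtain ⟨h0, h1, h2⟩ := hUsupp v hv
        omega
    · simp only [Walk.length_append, Walk.length_cons, hUlen]
      omega

/-! ### The registered stub -/

/-- **T-B · connector toolkit** (walk surgery on `SAW.stripSAWs`).
(T1) fresh-column connectors: a walk `(0,r) → (j,s)` of the `n`-strip of span `j`, translated one
column to the right and completed by the vertical connector `(0,1) ↑ (0,r) → (1,r)` in column `0`
and `(j+1,s) → (j+2,s) ↓ (j+2,1)` in column `j+2`, is a through walk of span `j+2` with `r+s` more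
steps: `x^{r+s} · Z_{n,j}((0,r)→(j,s)) ≤ Thr[x,n,j+2]`;
(T4) corner connectors in one fresh column (`ℓ ≥ 1`): `x^n · Thr[x,n,ℓ-1] ≤ Z(TL→BR)` (down column
`0`, one step right, translated through walk) and `x^n · Thr[x,n,ℓ-1] ≤ Z(BL→TR)` (through walk,
one step right, up column `ℓ`). [folklore] -/
theorem stub_connectorToolkit :
    (∀ (x : ℝ) (n j : ℕ) (r s : ℤ), 0 ≤ x → 1 ≤ r → r ≤ (n : ℤ) → 1 ≤ s → s ≤ (n : ℤ) →
      x ^ (r + s).toNat * Zs[x, n, j, ![0, r], ![(j : ℤ), s]] ≤ Thr[x, n, j + 2]) ∧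
    (∀ (x : ℝ) (n ℓ : ℕ), 0 ≤ x → 1 ≤ n → 1 ≤ ℓ →
      x ^ n * Thr[x, n, ℓ - 1] ≤ Zs[x, n, ℓ, ![0, (n : ℤ)], ![(ℓ : ℤ), 1]] ∧
      x ^ n * Thr[x, n, ℓ - 1] ≤ Zs[x, n, ℓ, ![0, 1], ![(ℓ : ℤ), (n : ℤ)]]) := by
  refine ⟨fun x n j r s hx h1r hrn h1s hsn => ?_, fun x n ℓ hx hn hℓ => ⟨?_, ?_⟩⟩
  · obtain ⟨f, hinj, hf⟩ := exists_freshColumnMap n j r s h1r hrn h1s hsn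
    exact pow_mul_zs_le hx f hinj hf
  · obtain ⟨f, hinj, hf⟩ := exists_cornerMapTL n ℓ hn hℓ
    exact pow_mul_zs_le hx f hinj hf
  · obtain ⟨f, hinj, hf⟩ := exists_cornerMapTR n ℓ hn hℓ
    exact pow_mul_zs_le hx f hinj hf

end Summit.CriticalPhenomena.SAWScalingLimit.Theorems.EdgeOfPositivity.RectangleWindows.ConnectorToolkit

end
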